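import Literature.NumberTheory.EllipticCurves.ModThreeCongruenceFlexTransport
import Literature.AlgebraicGeometry.PlaneCurves.PlaneCubicFlexTransitive
import Literature.AlgebraicGeometry.PlaneCurves.WeierstrassNineFlexes
import Literature.AlgebraicGeometry.PlaneCurves.WeierstrassHessian
import Literature.AlgebraicGeometry.PlaneCurves.HessianCovariance
import HarnessLib

/-!
# Mod-`3` congruences III-a: the harmonic polars of a Weierstrass cubic and their concurrence
# (the dual Hesse configuration; Artebani–Dolgachev §3)

Topic `Literature/NumberTheory/EllipticCurves`, namespace
`Literature.NumberTheory.EllipticCurves.FlexTransport` (Parts I/II: `ModThreeCongruenceFlexTransport`,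
`…Galois` — the projective-linear transport of flexes, which certifies DIRECT `3`-congruences). This file
supplies the one geometric theorem needed for the REVERSE (anti-symplectic) congruences, where the
transport goes through the dual plane: the flex `P` of `E'` is sent to the image under a projectivity of
its HARMONIC POLAR line. Everything here is PROVED; the only `def`s are explicit coordinate vectors.

## The objects

For the Weierstrass ternary cubic `F = Y²Z + a₁XYZ + a₃YZ² − (X³ + a₂X²Z + a₄XZ² + a₆Z³)` and a flex `p`
the polar conic `D_p F` splits as the inflection tangent times a second line, the *harmonic polar* of `p`
[cite: ArtebaniDolgachev2009, §3 ("By computing the polar P_{p_i}(E_λ) we find that it is equal to the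
union of the inflection tangent line 𝕋_{p_i}(E_λ) … and the line L_i … The lines L_0, …, L_8 are called the
harmonic polars … The harmonic polars, considered as points in the dual plane, give the set of base points
of a Hesse pencil in the dual plane")]. In the affine chart, at a flex `(x, y)` (a point with `Ψ₃(x) = 0`,
[cite: SilvermanTate2015, §2.1, Thm. 2.1 (c)]) the harmonic polar has the explicit coordinate vector
`ĥ(x, y)` (`hhat`; normalised by `t₂² = (2y + a₁x + a₃)²`), and `hess_split_affine` is the splitting
`t₂² · HessF(x, y, 1) = ∇F ⊗ ĥ + ĥ ⊗ ∇F` as six polynomial identities; at `O` the harmonic polar is the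
`2`-torsion line `a₁X + 2Y + a₃Z` (`hess_split_zero`).

## What is proved

* `hhat_negY`: `ĥ(x, −y − a₁x − a₃) = Nᵀ ĥ(x, y)` for the negation projectivity `N` of the cubic
  (tree `PlaneCubicFlexTransitive`, [cite: Kunz2005PlaneAlgebraicCurves, Ch. 10, proof of Lemma 10.11]).
* covariance of `∇F`, `HessF` and of the harmonic-polar vector `hpVec` under a projective automorphism
  `g` of the cubic, `F ∘ g = F` (tree `HessianCovariance`, [cite: Gibson1998, Lemma 13.1, Lemma 13.2]).
* **`det_hhat_eq_zero_of_collinear`** — the harmonic polars of three distinct collinear flexes are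
  CONCURRENT (over any field with `2 ≠ 0`, for any Weierstrass cubic, the flexes being nonsingular affine
  `3`-torsion points): the dual statement of "the nine harmonic polars are the base points of the dual
  Hesse pencil" [cite: ArtebaniDolgachev2009, §3]. Proof: Kunz's Lemma 10.11 (a projective automorphism
  of the cubic moves the first flex to `O`, tree `weierstrass_exists_projectivity_flex_to_e₁`
  [cite: Kunz2005PlaneAlgebraicCurves, Ch. 10, Lemma 10.11]), covariance, and the case of a line through
  `O`, where the three harmonic polars are the `2`-torsion line, `ĥ(Q)` and `Nᵀĥ(Q)` — concurrent
  identically (`det_hhatO_u_negU`: `N` is the harmonic homology with that axis and centre `O`).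

Part III-b (`ModThreeCongruenceDualTransport`) uses this exactly as Part I uses `Datum.collinear_transport`.

## References

* [ArtebaniDolgachev2009] M. Artebani, I. Dolgachev, *The Hesse pencil of plane cubic curves*,
  Enseign. Math. 55 (2009) 235–273, §3 (harmonic polars, the dual Hesse pencil).
* [Kunz2005PlaneAlgebraicCurves] E. Kunz, *Introduction to Plane Algebraic Curves* (2005), Ch. 10,
  Lemma 10.11.
* [Gibson1998] C. G. Gibson, *Elementary Geometry of Algebraic Curves* (1998), Lemma 13.1, 13.2.
* [SilvermanTate2015] J. H. Silverman, J. Tate, *Rational Points on Elliptic Curves*, 2nd ed., §2.1,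
  Thm. 2.1 (c).
* [Fisher2012Hessian] T. Fisher, *The Hessian of a genus one curve*, PLMS 104 (2012), §13 (Def. 13.1:
  reverse `n`-congruences, `X_E^-(n)`).
-/

set_option autoImplicit false

open MvPolynomial Matrix
open Literature.AlgebraicGeometry.PlaneCurves
open Literature.AlgebraicGeometry.HodgeTheory (hessianMatrix hessianMatrix_apply)
open Literature.AlgebraicGeometry.HyperbolicPolynomials
open scoped Classical

namespace Literature.NumberTheory.EllipticCurves.FlexTransport

universe u

variable {K : Type u} [Field K]

section Defs

/-- `ĥ_W(x, y)`: `t₂²` times the coordinate vector of the HARMONIC POLAR line of the Weierstrass cubic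
`W` at an affine flex `(x, y)` (`t₂ = 2y + a₁x + a₃`); at `O` the harmonic polar is the `2`-torsion line
`a₁X + 2Y + a₃Z`. [cite: ArtebaniDolgachev2009, §3 (harmonic polars)] -/
def hhat (W : WeierstrassCurve K) (x y : K) : Fin 3 → K :=
  ![3 * x ^ 2 + (W.a₁ ^ 2 + 2 * W.a₂) * x + W.a₁ * y + W.a₁ * W.a₃ + W.a₄,
    2 * y + W.a₁ * x + W.a₃,
    3 * y ^ 2 + 3 * W.a₁ * x * y + (W.a₁ ^ 2 + W.a₂) * x ^ 2 + 4 * W.a₃ * y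
      + (3 * W.a₁ * W.a₃ + 2 * W.a₄) * x + 2 * W.a₃ ^ 2 + 3 * W.a₆]

/-- The gradient `∇F(v)` of the Weierstrass ternary cubic `F = W.toProjective.polynomial`. [cite: Gibson1998, Lemma 13.2] -/
noncomputable def grad (W : WeierstrassCurve K) (v : Fin 3 → K) : Fin 3 → K :=
  fun j => eval v (pderiv j W.toProjective.polynomial)

/-- The Hessian matrix `(∂²F/∂Xᵢ∂Xⱼ)(v)` of the Weierstrass ternary cubic at `v`. [cite: Gibson1998, Lemma 13.1] -/
noncomputable def hess (W : WeierstrassCurve K) (v : Fin 3 → K) : Matrix (Fin 3) (Fin 3) K :=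
  (eval v).mapMatrix (hessianMatrix W.toProjective.polynomial)

/-- The (scaled) harmonic-polar vector computed with an auxiliary point `f`:
`2 (f·∇F(v)) · HessF(v) f − (fᵀ HessF(v) f) · ∇F(v)` (the polar conic of a flex minus its tangent part). [cite: ArtebaniDolgachev2009, §3 (harmonic polars)] -/
noncomputable def hpVec (W : WeierstrassCurve K) (v f : Fin 3 → K) : Fin 3 → K :=
  (2 * (f ⬝ᵥ grad W v)) • (hess W v *ᵥ f) - (f ⬝ᵥ (hess W v *ᵥ f)) • grad W v

end Defs

section Explicit

variable (W : WeierstrassCurve K)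

/-- The gradient of the Weierstrass cubic, written out (Mathlib `eval_polynomialX/Y/Z`). [cite: Gibson1998, Lemma 13.2] -/
theorem grad_explicit (v : Fin 3 → K) :
    grad W v = ![W.a₁ * v 1 * v 2 - (3 * v 0 ^ 2 + 2 * W.a₂ * v 0 * v 2 + W.a₄ * v 2 ^ 2),
      2 * v 1 * v 2 + W.a₁ * v 0 * v 2 + W.a₃ * v 2 ^ 2,
      v 1 ^ 2 + W.a₁ * v 0 * v 1 + 2 * W.a₃ * v 1 * v 2
        - (W.a₂ * v 0 ^ 2 + 2 * W.a₄ * v 0 * v 2 + 3 * W.a₆ * v 2 ^ 2)] := by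
  funext j
  fin_cases j
  · show eval v W.toProjective.polynomialX = _
    rw [WeierstrassCurve.Projective.eval_polynomialX]; simp
  · show eval v W.toProjective.polynomialY = _
    rw [WeierstrassCurve.Projective.eval_polynomialY]; simp
  · show eval v W.toProjective.polynomialZ = _
    rw [WeierstrassCurve.Projective.eval_polynomialZ]; simp

/-- Entries of `hess`. [cite: Gibson1998, Lemma 13.1] -/
theorem hess_apply (v : Fin 3 → K) (i j : Fin 3) :
    hess W v i j = eval v (hessianMatrix W.toProjective.polynomial i j) := rfl

/-- The Hessian matrix of the Weierstrass cubic at `v`, written out (tree `hessianMatrix_weierstrass`). [cite: Gibson1998, §15.2, proof of Lemma 15.3] -/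
theorem hess_explicit (v : Fin 3 → K) :
    hess W v = Matrix.of ![![-(6 * v 0 + 2 * W.a₂ * v 2), W.a₁ * v 2, W.a₁ * v 1 - 2 * W.a₂ * v 0 - 2 * W.a₄ * v 2],
      ![W.a₁ * v 2, 2 * v 2, 2 * v 1 + W.a₁ * v 0 + 2 * W.a₃ * v 2],
      ![W.a₁ * v 1 - 2 * W.a₂ * v 0 - 2 * W.a₄ * v 2, 2 * v 1 + W.a₁ * v 0 + 2 * W.a₃ * v 2,
        2 * W.a₃ * v 1 - 2 * W.a₄ * v 0 - 6 * W.a₆ * v 2]] := by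
  ext i j
  rw [hess_apply, hessianMatrix_weierstrass]
  fin_cases i <;> fin_cases j <;> simp [map_ofNat]

/-- `HessF` is linear in the point. [cite: Gibson1998, Lemma 13.1] -/
theorem hess_smul (c : K) (v : Fin 3 → K) : hess W (c • v) = c • hess W v := by
  rw [hess_explicit, hess_explicit]
  ext i j
  fin_cases i <;> fin_cases j <;> simp <;> ring

/-- `∇F` is quadratic in the point. [cite: Gibson1998, Lemma 13.2] -/
theorem grad_smul (c : K) (v : Fin 3 → K) : grad W (c • v) = c ^ 2 • grad W v := by
  rw [grad_explicit, grad_explicit]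
  funext j
  fin_cases j <;> simp <;> ring

/-- `det (hess W v)` is the Hessian determinant evaluated at `v`. [cite: Gibson1998, Lemma 13.1] -/
theorem det_hess (v : Fin 3 → K) :
    (hess W v).det = eval v (hessianMatrix W.toProjective.polynomial).det := by
  rw [hess, RingHom.map_det]

end Explicit


section Algebra

variable (W : WeierstrassCurve K)

/-- The negation projectivity `N = ((1,0,0),(−a₁,−1,−a₃),(0,0,1))` of `W` (tree `PlaneCubicFlexTransitive`, written as
a definition-free matrix here) acts on harmonic polars by its transpose: `ĥ(x, −y − a₁x − a₃) = Nᵀ ĥ(x, y)`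
identically. [cite: Kunz2005PlaneAlgebraicCurves, Ch. 10, Lemma 10.11] [cite: ArtebaniDolgachev2009, §3 (harmonic polars)] -/
theorem hhat_negY (x y : K) :
    hhat W x (W.toAffine.negY x y) =
      (Matrix.of ![![(1 : K), -W.a₁, 0], ![0, -1, 0], ![0, -W.a₃, 1]]) *ᵥ hhat W x y := by
  funext i
  fin_cases i <;> simp [hhat, Matrix.mulVec, dotProduct, Fin.sum_univ_three, WeierstrassCurve.Affine.negY]
  all_goals ring

/-- The harmonic polars of `O`, `Q` and `−Q` are concurrent — identically in the coordinates of `ĥ(Q) = u`: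
`det[(a₁, 2, a₃), u, Nᵀu] = 0` (`N` is the harmonic homology with axis the `2`-torsion line and centre `O`). [cite: ArtebaniDolgachev2009, §3 (harmonic polars)] [cite: Kunz2005PlaneAlgebraicCurves, Ch. 10, Lemma 10.11] -/
theorem det_hhatO_u_negU (u : Fin 3 → K) :
    (Matrix.of ![![W.a₁, 2, W.a₃], u,
      (Matrix.of ![![(1 : K), -W.a₁, 0], ![0, -1, 0], ![0, -W.a₃, 1]]) *ᵥ u]).det = 0 := by
  rw [Matrix.det_fin_three]
  simp [dotProduct, Fin.sum_univ_three]
  ring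

/-- **The polar conic of an affine flex splits off the harmonic polar**: for an affine point `(x, y)` of `W` with
`Ψ₃(x) = 0`, `t₂² · HessF(x,y,1) = ∇F ⊗ ĥ + ĥ ⊗ ∇F` (`t₂ = 2y + a₁x + a₃`), six polynomial identities modulo the
Weierstrass equation and `Ψ₃(x) = 0`. [cite: ArtebaniDolgachev2009, §3 (the polar of a base point = inflection tangent
∪ harmonic polar)] -/
theorem hess_split_affine {x y : K} (hE : W.toAffine.Equation x y) (hΨ : W.Ψ₃.eval x = 0) :
    (2 * y + W.a₁ * x + W.a₃) ^ 2 • hess W ![x, y, 1] =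
      vecMulVec (grad W ![x, y, 1]) (hhat W x y) + vecMulVec (hhat W x y) (grad W ![x, y, 1]) := by
  rw [WeierstrassCurve.Affine.equation_iff] at hE
  simp only [WeierstrassCurve.Ψ₃, WeierstrassCurve.b₂, WeierstrassCurve.b₄, WeierstrassCurve.b₆,
    WeierstrassCurve.b₈, Polynomial.eval_add, Polynomial.eval_mul, Polynomial.eval_pow, Polynomial.eval_C,
    Polynomial.eval_X, Polynomial.eval_ofNat] at hΨ
  rw [hess_explicit, grad_explicit]
  ext i j
  fin_cases i <;> fin_cases j <;>
    simp [hhat, vecMulVec, Matrix.smul_apply]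
  · linear_combination (-24*x - 2*W.a₁^2 - 8*W.a₂) * hE + (-2) * hΨ
  · ring
  · linear_combination (6*x^2 - x*W.a₁^2 - 4*x*W.a₂ - 3*W.a₁*W.a₃ - 6*W.a₄) * hE + (2*x) * hΨ
  · ring
  · ring
  · ring
  · linear_combination (6*x^2 - x*W.a₁^2 - 4*x*W.a₂ - 3*W.a₁*W.a₃ - 6*W.a₄) * hE + (2*x) * hΨ
  · ring
  · linear_combination (-6*x^3 - 2*x^2*W.a₁^2 - 2*x^2*W.a₂ - 6*x*y*W.a₁ - 6*x*W.a₁*W.a₃ - 6*x*W.a₄ - 6*y^2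
      - 6*y*W.a₃ - 6*W.a₃^2 - 18*W.a₆) * hE + (-2*x^2) * hΨ

/-- The splitting at the point at infinity: `HessF(O) = ∇F(O) ⊗ k_O + k_O ⊗ ∇F(O)` with `∇F(O) = (0,0,1)` and
`k_O = (a₁, 2, a₃)` (the `2`-torsion line). [cite: ArtebaniDolgachev2009, §3 (harmonic polars)] [cite: SilvermanTate2015, §2.1, Thm. 2.1 (c)] -/
theorem hess_split_zero :
    (1 : K) • hess W ![0, 1, 0] =
      vecMulVec (grad W ![0, 1, 0]) ![W.a₁, 2, W.a₃] + vecMulVec ![W.a₁, 2, W.a₃] (grad W ![0, 1, 0]) := by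
  rw [hess_explicit, grad_explicit]
  ext i j
  fin_cases i <;> fin_cases j <;> simp [vecMulVec]
  all_goals ring

/-- `∇F(O) = (0, 0, 1)`: the flex tangent at `O` is the line at infinity. [cite: SilvermanTate2015, §2.1] -/
theorem grad_zero_eq : grad W ![0, 1, 0] = ![0, 0, 1] := by
  rw [grad_explicit]; funext j; fin_cases j <;> simp

/-- The `Y`-partial at an affine point: `t₂ = 2y + a₁x + a₃`. [cite: SilvermanTate2015, §2.1] -/
theorem grad_affine_one (x y : K) : grad W ![x, y, 1] 1 = 2 * y + W.a₁ * x + W.a₃ := by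
  rw [grad_explicit]; simp

/-- From a splitting `c · HessF(v) = t ⊗ h + h ⊗ t` (`t = ∇F(v)`): `c · hpVec(v, f) = 2 (f·t)² · h` (the harmonic polar does not depend on the auxiliary point). [cite: ArtebaniDolgachev2009, §3 (harmonic polars)] -/
theorem smul_hpVec_of_split {v f t h : Fin 3 → K} {c : K} (ht : grad W v = t)
    (hS : c • hess W v = vecMulVec t h + vecMulVec h t) :
    c • hpVec W v f = (2 * (f ⬝ᵥ t) ^ 2) • h := by
  have e : ∀ i j, c * hess W v i j = t i * h j + h i * t j := fun i j => by
    have := congrFun (congrFun hS i) j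
    simpa [vecMulVec, Matrix.smul_apply] using this
  simp only [hpVec, ht]
  funext i
  simp only [Pi.smul_apply, Pi.sub_apply, smul_eq_mul, Matrix.mulVec, dotProduct, Fin.sum_univ_three]
  fin_cases i
  · show c * (2 * (f 0 * t 0 + f 1 * t 1 + f 2 * t 2) * (hess W v 0 0 * f 0 + hess W v 0 1 * f 1 + hess W v 0 2 * f 2)
        - (f 0 * (hess W v 0 0 * f 0 + hess W v 0 1 * f 1 + hess W v 0 2 * f 2)
          + f 1 * (hess W v 1 0 * f 0 + hess W v 1 1 * f 1 + hess W v 1 2 * f 2)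
          + f 2 * (hess W v 2 0 * f 0 + hess W v 2 1 * f 1 + hess W v 2 2 * f 2)) * t 0)
        = 2 * (f 0 * t 0 + f 1 * t 1 + f 2 * t 2) ^ 2 * h 0
    linear_combination (2 * (f 0 * t 0 + f 1 * t 1 + f 2 * t 2) * f 0) * e 0 0 + (2 * (f 0 * t 0 + f 1 * t 1 + f 2 * t 2) * f 1) * e 0 1 + (2 * (f 0 * t 0 + f 1 * t 1 + f 2 * t 2) * f 2) * e 0 2 + (- (t 0) * f 0 * f 0) * e 0 0 + (- (t 0) * f 0 * f 1) * e 0 1 + (- (t 0) * f 0 * f 2) * e 0 2 + (- (t 0) * f 1 * f 0) * e 1 0 + (- (t 0) * f 1 * f 1) * e 1 1 + (- (t 0) * f 1 * f 2) * e 1 2 + (- (t 0) * f 2 * f 0) * e 2 0 + (- (t 0) * f 2 * f 1) * e 2 1 + (- (t 0) * f 2 * f 2) * e 2 2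
  · show c * (2 * (f 0 * t 0 + f 1 * t 1 + f 2 * t 2) * (hess W v 1 0 * f 0 + hess W v 1 1 * f 1 + hess W v 1 2 * f 2)
        - (f 0 * (hess W v 0 0 * f 0 + hess W v 0 1 * f 1 + hess W v 0 2 * f 2)
          + f 1 * (hess W v 1 0 * f 0 + hess W v 1 1 * f 1 + hess W v 1 2 * f 2)
          + f 2 * (hess W v 2 0 * f 0 + hess W v 2 1 * f 1 + hess W v 2 2 * f 2)) * t 1)
        = 2 * (f 0 * t 0 + f 1 * t 1 + f 2 * t 2) ^ 2 * h 1
    linear_combination (2 * (f 0 * t 0 + f 1 * t 1 + f 2 * t 2) * f 0) * e 1 0 + (2 * (f 0 * t 0 + f 1 * t 1 + f 2 * t 2) * f 1) * e 1 1 + (2 * (f 0 * t 0 + f 1 * t 1 + f 2 * t 2) * f 2) * e 1 2 + (- (t 1) * f 0 * f 0) * e 0 0 + (- (t 1) * f 0 * f 1) * e 0 1 + (- (t 1) * f 0 * f 2) * e 0 2 + (- (t 1) * f 1 * f 0) * e 1 0 + (- (t 1) * f 1 * f 1) * e 1 1 + (- (t 1) * f 1 * f 2) * e 1 2 + (- (t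 1) * f 2 * f 0) * e 2 0 + (- (t 1) * f 2 * f 1) * e 2 1 + (- (t 1) * f 2 * f 2) * e 2 2
  · show c * (2 * (f 0 * t 0 + f 1 * t 1 + f 2 * t 2) * (hess W v 2 0 * f 0 + hess W v 2 1 * f 1 + hess W v 2 2 * f 2)
        - (f 0 * (hess W v 0 0 * f 0 + hess W v 0 1 * f 1 + hess W v 0 2 * f 2)
          + f 1 * (hess W v 1 0 * f 0 + hess W v 1 1 * f 1 + hess W v 1 2 * f 2)
          + f 2 * (hess W v 2 0 * f 0 + hess W v 2 1 * f 1 + hess W v 2 2 * f 2)) * t 2)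
        = 2 * (f 0 * t 0 + f 1 * t 1 + f 2 * t 2) ^ 2 * h 2
    linear_combination (2 * (f 0 * t 0 + f 1 * t 1 + f 2 * t 2) * f 0) * e 2 0 + (2 * (f 0 * t 0 + f 1 * t 1 + f 2 * t 2) * f 1) * e 2 1 + (2 * (f 0 * t 0 + f 1 * t 1 + f 2 * t 2) * f 2) * e 2 2 + (- (t 2) * f 0 * f 0) * e 0 0 + (- (t 2) * f 0 * f 1) * e 0 1 + (- (t 2) * f 0 * f 2) * e 0 2 + (- (t 2) * f 1 * f 0) * e 1 0 + (- (t 2) * f 1 * f 1) * e 1 1 + (- (t 2) * f 1 * f 2) * e 1 2 + (- (t 2) * f 2 * f 0) * e 2 0 + (- (t 2) * f 2 * f 1) * e 2 1 + (- (t 2) * f 2 * f 2) * e 2 2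

/-- Scaling a split point: a splitting at `v` gives one at `z • v` (`HessF` is linear, `∇F` quadratic in `v`). [cite: Gibson1998, Lemma 13.1] -/
theorem split_smul {v t h : Fin 3 → K} {c z : K} (hz : z ≠ 0) (ht : grad W v = t)
    (hS : c • hess W v = vecMulVec t h + vecMulVec h t) :
    c • hess W (z • v) = vecMulVec (grad W (z • v)) (z⁻¹ • h) + vecMulVec (z⁻¹ • h) (grad W (z • v)) := by
  rw [hess_smul, grad_smul, ht, smul_comm, hS]
  ext i j
  simp [vecMulVec, Matrix.smul_apply]
  field_simp

end Algebra

section Covariance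

variable (W : WeierstrassCurve K)

/-- **Gradient covariance** under a projective automorphism `g` of the cubic (`F ∘ g = F`): `∇F(v) = gᵀ ∇F(g v)`.
[cite: Gibson1998, Lemma 13.2 (proof)] -/
theorem grad_eq_transpose_mulVec {g : Matrix (Fin 3) (Fin 3) K}
    (hg : bind₁ g.toMvPolynomial W.toProjective.polynomial = W.toProjective.polynomial) (v : Fin 3 → K) :
    grad W v = gᵀ *ᵥ grad W (g *ᵥ v) := by
  have h := grad_bind₁_toMvPolynomial g W.toProjective.polynomial v
  rw [hg] at h
  rw [Matrix.mulVec_transpose]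
  exact h

/-- **Hessian covariance** under `F ∘ g = F`: `HessF(v) = gᵀ · HessF(g v) · g`. [cite: Gibson1998, Lemma 13.1 (proof)] -/
theorem hess_eq_transpose_mul {g : Matrix (Fin 3) (Fin 3) K}
    (hg : bind₁ g.toMvPolynomial W.toProjective.polynomial = W.toProjective.polynomial) (v : Fin 3 → K) :
    hess W v = gᵀ * hess W (g *ᵥ v) * g := by
  have H := hessianMatrix_bind₁_toMvPolynomial g W.toProjective.polynomial
  rw [hg] at H
  have H' := congrArg (eval v).mapMatrix H
  rw [map_mul, map_mul] at H'
  rw [hess, H', hess]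
  congr 1
  · congr 1
    · ext i j; simp [Matrix.transpose_apply, Matrix.map_apply]
    · ext i j; simp [Matrix.map_apply, eval_bind₁_toMvPolynomial]
  · ext i j; simp [Matrix.map_apply]

/-- **Covariance of the harmonic-polar vector**: `gᵀ · hpVec(g v, g f) = hpVec(v, f)` for `F ∘ g = F`. [cite: Gibson1998, Lemma 13.1] [cite: Gibson1998, Lemma 13.2] -/
theorem transpose_mulVec_hpVec {g : Matrix (Fin 3) (Fin 3) K}
    (hg : bind₁ g.toMvPolynomial W.toProjective.polynomial = W.toProjective.polynomial) (v f : Fin 3 → K) :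
    gᵀ *ᵥ hpVec W (g *ᵥ v) (g *ᵥ f) = hpVec W v f := by
  rw [hpVec, hpVec, grad_eq_transpose_mulVec W hg v, hess_eq_transpose_mul W hg v]
  have h1 : f ⬝ᵥ (gᵀ *ᵥ grad W (g *ᵥ v)) = (g *ᵥ f) ⬝ᵥ grad W (g *ᵥ v) := by
    rw [Matrix.dotProduct_mulVec, Matrix.vecMul_transpose]
  have h2 : (gᵀ * hess W (g *ᵥ v) * g) *ᵥ f = gᵀ *ᵥ (hess W (g *ᵥ v) *ᵥ (g *ᵥ f)) := by
    rw [Matrix.mulVec_mulVec, Matrix.mulVec_mulVec]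
  have h3 : f ⬝ᵥ (gᵀ *ᵥ (hess W (g *ᵥ v) *ᵥ (g *ᵥ f))) = (g *ᵥ f) ⬝ᵥ (hess W (g *ᵥ v) *ᵥ (g *ᵥ f)) := by
    rw [Matrix.dotProduct_mulVec, Matrix.vecMul_transpose]
  rw [h1, h2, h3, Matrix.mulVec_sub, Matrix.mulVec_smul, Matrix.mulVec_smul]

end Covariance


section Main

variable (W : WeierstrassCurve K)

/-- `3`-torsion affine points have `t₂ = 2y + a₁x + a₃ ≠ 0` (`P ≠ −P`). [cite: SilvermanTate2015, §2.1, p. 39 ("Instead of 3P = O, we write 2P = −P")] -/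
theorem t₂_ne_zero_of_three_zsmul {x y : K} (h : W.toAffine.Nonsingular x y)
    (hP : (3 : ℤ) • WeierstrassCurve.Affine.Point.some x y h = 0) : 2 * y + W.a₁ * x + W.a₃ ≠ 0 := by
  intro h0
  apply ne_neg_of_three_zsmul hP (WeierstrassCurve.Affine.Point.some_ne_zero h)
  rw [WeierstrassCurve.Affine.Point.neg_some, WeierstrassCurve.Affine.Point.some.injEq]
  refine ⟨rfl, ?_⟩
  rw [WeierstrassCurve.Affine.negY]
  linear_combination h0

/-- Rows of the form `αᵢ · gᵀ rᵢ`: the determinant factors through `det g · det(r)` (multiplicativity of `det`). [cite: Gibson1998, Lemma 13.1] -/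
theorem det_rows_smul_transpose_mulVec (g : Matrix (Fin 3) (Fin 3) K) (α₁ α₂ α₃ : K)
    (r₁ r₂ r₃ : Fin 3 → K) :
    (Matrix.of ![α₁ • (gᵀ *ᵥ r₁), α₂ • (gᵀ *ᵥ r₂), α₃ • (gᵀ *ᵥ r₃)]).det =
      α₁ * α₂ * α₃ * g.det * (Matrix.of ![r₁, r₂, r₃]).det := by
  have h : Matrix.of ![α₁ • (gᵀ *ᵥ r₁), α₂ • (gᵀ *ᵥ r₂), α₃ • (gᵀ *ᵥ r₃)] =
      Matrix.diagonal ![α₁, α₂, α₃] * Matrix.of ![r₁, r₂, r₃] * g := by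
    ext i j
    fin_cases i <;> fin_cases j <;>
      simp [Matrix.mul_apply, Matrix.mulVec, dotProduct, Fin.sum_univ_three, Matrix.diagonal] <;> ring
  rw [h, Matrix.det_mul, Matrix.det_mul, Matrix.det_diagonal]
  simp [Fin.prod_univ_three]
  ring

/-- If `g v = c · g v'` for affine representatives `v = (x, y, 1)`, `v' = (x', y', 1)` and `det g ≠ 0`, the points
coincide. [cite: Gibson1998, Lemma 13.2] -/
theorem eq_of_mulVec_eq_smul {g : Matrix (Fin 3) (Fin 3) K} (hg : g.det ≠ 0) {x y x' y' c : K}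
    (h : g *ᵥ ![x, y, 1] = c • (g *ᵥ ![x', y', 1])) : (x, y) = (x', y') := by
  have h0 : g *ᵥ (![x, y, 1] - c • ![x', y', 1]) = 0 := by
    rw [Matrix.mulVec_sub, Matrix.mulVec_smul, h, sub_self]
  have hv := Matrix.eq_zero_of_mulVec_eq_zero hg h0
  have e2 := congrFun hv 2
  have e0 := congrFun hv 0
  have e1 := congrFun hv 1
  simp at e0 e1 e2
  have hc : c = 1 := by linear_combination -e2
  subst hc
  simp only [Prod.mk.injEq]
  exact ⟨by linear_combination e0, by linear_combination e1⟩

/-- The key transport step: a splitting at `w = g v` and the splitting at the affine flex `v = (x, y, 1)` give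
`ĥ(x, y) = α · gᵀ h` for some scalar `α`. [cite: ArtebaniDolgachev2009, §3 (harmonic polars)] [cite: Gibson1998, Lemma 13.1] -/
theorem hhat_eq_smul_transpose_mulVec (h2 : (2 : K) ≠ 0) {g : Matrix (Fin 3) (Fin 3) K}
    (hg : bind₁ g.toMvPolynomial W.toProjective.polynomial = W.toProjective.polynomial)
    {x y : K} (hE : W.toAffine.Equation x y) (hΨ : W.Ψ₃.eval x = 0) (ht2 : 2 * y + W.a₁ * x + W.a₃ ≠ 0)
    {w t h : Fin 3 → K} (hw : g *ᵥ ![x, y, 1] = w) {c : K} (hc : c ≠ 0) (ht : grad W w = t)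
    (hS : c • hess W w = vecMulVec t h + vecMulVec h t) :
    ∃ α : K, hhat W x y = α • (gᵀ *ᵥ h) := by
  set e : Fin 3 → K := ![0, 1, 0] with he
  -- (A) at `v`: `hpVec(v, e) = 2 ĥ`
  have hev : e ⬝ᵥ grad W ![x, y, 1] = 2 * y + W.a₁ * x + W.a₃ := by
    rw [grad_explicit]; simp [e, dotProduct, Fin.sum_univ_three]
  have hA := smul_hpVec_of_split W (v := ![x, y, 1]) (f := e) rfl (hess_split_affine W hE hΨ)
  rw [hev] at hA
  -- (B) covariance
  have hB := transpose_mulVec_hpVec W hg ![x, y, 1] e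
  rw [hw] at hB
  -- (C) at `w`
  have hew : (g *ᵥ e) ⬝ᵥ t = 2 * y + W.a₁ * x + W.a₃ := by
    rw [← hev, grad_eq_transpose_mulVec W hg ![x, y, 1], hw, ht, Matrix.dotProduct_mulVec,
      Matrix.vecMul_transpose]
  have hC := smul_hpVec_of_split W (v := w) (f := g *ᵥ e) ht hS
  rw [hew] at hC
  -- combine
  have hC' : hpVec W w (g *ᵥ e) = (c⁻¹ * (2 * (2 * y + W.a₁ * x + W.a₃) ^ 2)) • h := by
    rw [mul_smul, ← hC, smul_smul, inv_mul_cancel₀ hc, one_smul]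
  have h2h : (2 : K) • hhat W x y = hpVec W ![x, y, 1] e := by
    have h' : (2 * y + W.a₁ * x + W.a₃) ^ 2 • ((2 : K) • hhat W x y) =
        (2 * y + W.a₁ * x + W.a₃) ^ 2 • hpVec W ![x, y, 1] e := by
      rw [hA, smul_smul, mul_comm]
    exact smul_right_injective (Fin 3 → K) (pow_ne_zero 2 ht2) h'
  refine ⟨2⁻¹ * (c⁻¹ * (2 * (2 * y + W.a₁ * x + W.a₃) ^ 2)), ?_⟩
  calc hhat W x y = (2 : K)⁻¹ • ((2 : K) • hhat W x y) := by
        rw [smul_smul, inv_mul_cancel₀ h2, one_smul]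
    _ = (2 : K)⁻¹ • (gᵀ *ᵥ hpVec W w (g *ᵥ e)) := by rw [h2h, hB]
    _ = _ := by rw [hC', Matrix.mulVec_smul, smul_smul]

/-- **Harmonic polars of three collinear flexes are concurrent** (the dual Hesse configuration,
[cite: ArtebaniDolgachev2009, §3 (the nine harmonic polars, base points of the dual Hesse pencil)]): for a
Weierstrass cubic `W` over a field with `2 ≠ 0` and three pairwise distinct collinear nonsingular affine `3`-torsion
points `Pᵢ = (xᵢ, yᵢ)`, the harmonic-polar covectors are linearly dependent: `det[ĥ(P₁), ĥ(P₂), ĥ(P₃)] = 0`.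
Proof (Kunz, Lemma 10.11 [cite: Kunz2005PlaneAlgebraicCurves, Ch. 10, Lemma 10.11]: a projective automorphism of
`W` moves `P₁` to `O`, `PlaneCubicFlexTransitive`), covariance of the polar conic / harmonic polar
[cite: Gibson1998, Lemma 13.1], and the case of a line through `O`, where the three harmonic polars are the
`2`-torsion line and the pair `ĥ(Q)`, `Nᵀĥ(Q)` exchanged by the negation homology. -/
theorem det_hhat_eq_zero_of_collinear (h2 : (2 : K) ≠ 0) {x₁ y₁ x₂ y₂ x₃ y₃ : K}
    (h₁ : W.toAffine.Nonsingular x₁ y₁) (h₂ : W.toAffine.Nonsingular x₂ y₂)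
    (h₃ : W.toAffine.Nonsingular x₃ y₃)
    (hP₁ : (3 : ℤ) • WeierstrassCurve.Affine.Point.some x₁ y₁ h₁ = 0)
    (hP₂ : (3 : ℤ) • WeierstrassCurve.Affine.Point.some x₂ y₂ h₂ = 0)
    (hP₃ : (3 : ℤ) • WeierstrassCurve.Affine.Point.some x₃ y₃ h₃ = 0)
    (h₁₂ : (x₁, y₁) ≠ (x₂, y₂)) (h₁₃ : (x₁, y₁) ≠ (x₃, y₃)) (h₂₃ : (x₂, y₂) ≠ (x₃, y₃))
    (hcol : (y₂ - y₁) * (x₃ - x₁) = (y₃ - y₁) * (x₂ - x₁)) :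
    (Matrix.of ![hhat W x₁ y₁, hhat W x₂ y₂, hhat W x₃ y₃]).det = 0 := by
  classical
  set F := W.toProjective.polynomial with hF
  -- equations, `Ψ₃ = 0`, `t₂ ≠ 0`
  have hE₁ : W.toAffine.Equation x₁ y₁ := h₁.1
  have hE₂ : W.toAffine.Equation x₂ y₂ := h₂.1
  have hE₃ : W.toAffine.Equation x₃ y₃ := h₃.1
  have hΨ₁ : W.Ψ₃.eval x₁ = 0 := (three_zsmul_some_eq_zero_iff W h₁).1 hP₁
  have hΨ₂ : W.Ψ₃.eval x₂ = 0 := (three_zsmul_some_eq_zero_iff W h₂).1 hP₂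
  have hΨ₃ : W.Ψ₃.eval x₃ = 0 := (three_zsmul_some_eq_zero_iff W h₃).1 hP₃
  have ht₁ := t₂_ne_zero_of_three_zsmul W h₁ hP₁
  have ht₂ := t₂_ne_zero_of_three_zsmul W h₂ hP₂
  have ht₃ := t₂_ne_zero_of_three_zsmul W h₃ hP₃
  -- the flex `v₁` and a projective automorphism moving it to `O`
  have hf₁ := (weierstrass_flex_iff_three_nsmul_eq_zero W h₁).2
    (by rw [← natCast_zsmul]; exact_mod_cast hP₁)
  have hq₁ : eval ![x₁, y₁, 1] F = 0 := (WeierstrassCurve.Projective.equation_some x₁ y₁).2 hE₁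
  have hgrad : (fun j => eval ![x₁, y₁, 1] (pderiv j F)) ≠ 0 := by
    rw [hF, eval_pderiv_weierstrass_affine]
    intro h0
    have hx := congrFun h0 0
    have hy := congrFun h0 1
    simp only [Matrix.cons_val_zero, Matrix.cons_val_one, Pi.zero_apply] at hx hy
    rcases h₁.2 with h | h
    · exact h hx
    · exact h hy
  have hv₁0 : (![x₁, y₁, 1] : Fin 3 → K) ≠ 0 := fun h => by simpa using congrFun h 2
  obtain ⟨g, hgdet, hg, l, hl, hgv₁⟩ := weierstrass_exists_projectivity_flex_to_e₁ W hv₁0 hq₁ hgrad hf₁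
  -- the images `wᵢ = g vᵢ` (`i = 2, 3`) lie on the curve …
  have hFw : ∀ x y : K, W.toAffine.Equation x y → eval (g *ᵥ ![x, y, 1]) F = 0 := fun x y hE => by
    rw [← eval_bind₁_toMvPolynomial, hg]
    exact (WeierstrassCurve.Projective.equation_some x y).2 hE
  -- … and are affine
  have hw2 : ∀ x y : K, W.toAffine.Equation x y → (x₁, y₁) ≠ (x, y) → (g *ᵥ ![x, y, 1]) 2 ≠ 0 := by
    intro x y hE hne h0
    have hx0 : (g *ᵥ ![x, y, 1]) 0 = 0 :=
      pow_eq_zero_iff three_ne_zero |>.1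
        ((WeierstrassCurve.Projective.equation_of_Z_eq_zero h0).1 (hFw x y hE))
    apply hne
    refine (eq_of_mulVec_eq_smul hgdet (x := x) (y := y) (c := (g *ᵥ ![x, y, 1]) 1 * l⁻¹) ?_).symm
    rw [hgv₁]
    funext j
    fin_cases j
    · simp [hx0]
    · simp [inv_mul_cancel_right₀ hl]
    · simp [h0]
  have hz₂ := hw2 x₂ y₂ hE₂ h₁₂
  have hz₃ := hw2 x₃ y₃ hE₃ h₁₃
  -- affine coordinates of the images
  set w₂ := g *ᵥ ![x₂, y₂, 1] with hw₂
  set w₃ := g *ᵥ ![x₃, y₃, 1] with hw₃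
  set x₂' := w₂ 0 / w₂ 2 with hx₂'
  set y₂' := w₂ 1 / w₂ 2 with hy₂'
  set x₃' := w₃ 0 / w₃ 2 with hx₃'
  set y₃' := w₃ 1 / w₃ 2 with hy₃'
  have hw₂q : w₂ = w₂ 2 • ![x₂', y₂', 1] := by
    funext j; fin_cases j
    · simp [hx₂', mul_div_cancel₀ _ hz₂]
    · simp [hy₂', mul_div_cancel₀ _ hz₂]
    · simp
  have hw₃q : w₃ = w₃ 2 • ![x₃', y₃', 1] := by
    funext j; fin_cases j
    · simp [hx₃', mul_div_cancel₀ _ hz₃]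
    · simp [hy₃', mul_div_cancel₀ _ hz₃]
    · simp
  -- equations of the images
  have hEq : ∀ {w : Fin 3 → K} {x y : K}, w 2 ≠ 0 → w = w 2 • ![x, y, 1] → eval w F = 0 →
      W.toAffine.Equation x y := by
    intro w x y hz hw hw0
    have h' : W.toProjective.Equation (w 2 • ![x, y, 1]) := by rw [← hw]; exact hw0
    exact (WeierstrassCurve.Projective.equation_some x y).1
      ((WeierstrassCurve.Projective.equation_smul _ (isUnit_iff_ne_zero.2 hz)).1 h')
  have hE₂' : W.toAffine.Equation x₂' y₂' := hEq hz₂ hw₂q (hFw x₂ y₂ hE₂)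
  have hE₃' : W.toAffine.Equation x₃' y₃' := hEq hz₃ hw₃q (hFw x₃ y₃ hE₃)
  -- `Ψ₃ = 0` at the images (the Hessian determinant is a covariant)
  have h8 : (8 : K) ≠ 0 := by
    rw [show (8 : K) = 2 ^ 3 by norm_num]; exact pow_ne_zero 3 h2
  have hΨq : ∀ {w : Fin 3 → K} {x y x₀ y₀ : K}, w 2 ≠ 0 → w = w 2 • ![x, y, 1] → g *ᵥ ![x₀, y₀, 1] = w →
      W.toAffine.Equation x₀ y₀ → W.Ψ₃.eval x₀ = 0 → W.toAffine.Equation x y → W.Ψ₃.eval x = 0 := by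
    intro w x y x₀ y₀ hz hw hgw hE₀ hΨ₀ hE
    have hv : eval ![x₀, y₀, 1] (hessianMatrix F).det = 0 := by
      rw [hF, eval_det_hessianMatrix_weierstrass_of_equation W hE₀, hΨ₀, mul_zero]
    have hcov := eval_det_hessianMatrix_bind₁_eq_zero_iff hgdet F ![x₀, y₀, 1]
    rw [hg, hgw] at hcov
    have hw' : (hess W w).det = 0 := by rw [det_hess]; exact hcov.1 hv
    rw [hw, hess_smul, Matrix.det_smul, Fintype.card_fin, det_hess,
      eval_det_hessianMatrix_weierstrass_of_equation W hE, mul_eq_zero] at hw'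
    rcases hw' with h' | h'
    · exact absurd (pow_eq_zero_iff three_ne_zero |>.1 h') hz
    · rcases mul_eq_zero.1 h' with h'' | h''
      · exact absurd h'' h8
      · exact h''
  have hΨ₂' : W.Ψ₃.eval x₂' = 0 := hΨq hz₂ hw₂q rfl hE₂ hΨ₂ hE₂'
  have hΨ₃' : W.Ψ₃.eval x₃' = 0 := hΨq hz₃ hw₃q rfl hE₃ hΨ₃ hE₃'
  -- collinearity of the images: `x₂' = x₃'`
  have hdetv : (Matrix.of ![![x₁, y₁, (1 : K)], ![x₂, y₂, 1], ![x₃, y₃, 1]]).det = 0 := by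
    rw [Matrix.det_fin_three]; simp; linear_combination -hcol
  have hVg : Matrix.of ![g *ᵥ ![x₁, y₁, 1], g *ᵥ ![x₂, y₂, 1], g *ᵥ ![x₃, y₃, 1]] =
      Matrix.of ![![x₁, y₁, (1 : K)], ![x₂, y₂, 1], ![x₃, y₃, 1]] * gᵀ := by
    ext i j
    fin_cases i <;> simp [Matrix.mul_apply, Matrix.mulVec, dotProduct, Fin.sum_univ_three] <;> ring
  have hdetw : (Matrix.of ![g *ᵥ ![x₁, y₁, 1], g *ᵥ ![x₂, y₂, 1], g *ᵥ ![x₃, y₃, 1]]).det = 0 := by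
    rw [hVg, Matrix.det_mul, hdetv, zero_mul]
  have hx' : x₃' = x₂' := by
    rw [hgv₁, ← hw₂, ← hw₃, hw₂q, hw₃q, Matrix.det_fin_three] at hdetw
    simp at hdetw
    have : l * w₂ 2 * w₃ 2 * (x₃' - x₂') = 0 := by linear_combination hdetw
    rcases mul_eq_zero.1 this with h | h
    · rcases mul_eq_zero.1 h with h' | h'
      · rcases mul_eq_zero.1 h' with h'' | h''
        · exact absurd h'' hl
        · exact absurd h'' hz₂
      · exact absurd h' hz₃
    · linear_combination h
  -- the images are opposite: `y₃' = −y₂' − a₁x₂' − a₃`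
  have hy' : y₃' = W.toAffine.negY x₂' y₂' := by
    rcases WeierstrassCurve.Affine.Y_eq_of_X_eq hE₃' hE₂' hx' with h | h
    · exfalso
      apply h₂₃
      have hw23 : w₃ = (w₃ 2 * (w₂ 2)⁻¹) • w₂ :=
        calc w₃ = w₃ 2 • ![x₃', y₃', 1] := hw₃q
          _ = w₃ 2 • ![x₂', y₂', 1] := by rw [hx', h]
          _ = (w₃ 2 * (w₂ 2)⁻¹) • (w₂ 2 • ![x₂', y₂', 1]) := by
              rw [smul_smul, mul_assoc, inv_mul_cancel₀ hz₂, mul_one]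
          _ = (w₃ 2 * (w₂ 2)⁻¹) • w₂ := by rw [← hw₂q]
      exact (eq_of_mulVec_eq_smul hgdet hw23).symm
    · exact h
  -- the images are nonsingular `3`-torsion points, so `t₂ ≠ 0` there
  have hns : ∀ {x y : K} (hn : W.toAffine.Nonsingular x y) {w : Fin 3 → K} {x' y' : K},
      g *ᵥ ![x, y, 1] = w → w 2 ≠ 0 → w = w 2 • ![x', y', 1] → W.toAffine.Equation x' y' →
        W.toAffine.Nonsingular x' y' := by
    intro x y hn w x' y' hgw hz hwq hE'
    refine ⟨hE', ?_⟩
    by_contra hc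
    rw [not_or, not_ne_iff, not_ne_iff] at hc
    have hX : W.a₁ * y' = 3 * x' ^ 2 + 2 * W.a₂ * x' + W.a₄ := by
      have := hc.1; rw [WeierstrassCurve.Affine.evalEval_polynomialX] at this; linear_combination this
    have hY : 2 * y' + W.a₁ * x' + W.a₃ = 0 := by
      have := hc.2; rwa [WeierstrassCurve.Affine.evalEval_polynomialY] at this
    have hg0 : grad W ![x', y', 1] = 0 := (weierstrass_grad_eq_zero_of_singular W hE' hX hY).2
    have hgv : grad W ![x, y, 1] = 0 := by
      rw [grad_eq_transpose_mulVec W hg, hgw, hwq, grad_smul, hg0, smul_zero, Matrix.mulVec_zero]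
    rw [grad_explicit] at hgv
    have hx := congrFun hgv 0
    have hy := congrFun hgv 1
    simp at hx hy
    rcases hn.2 with h | h
    · apply h; rw [WeierstrassCurve.Affine.evalEval_polynomialX]; linear_combination hx
    · apply h; rw [WeierstrassCurve.Affine.evalEval_polynomialY]; linear_combination hy
  have hn₂ : W.toAffine.Nonsingular x₂' y₂' := hns h₂ rfl hz₂ hw₂q hE₂'
  have hn₃ : W.toAffine.Nonsingular x₃' y₃' := hns h₃ rfl hz₃ hw₃q hE₃'
  have ht₂' : 2 * y₂' + W.a₁ * x₂' + W.a₃ ≠ 0 :=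
    t₂_ne_zero_of_three_zsmul W hn₂ ((three_zsmul_some_eq_zero_iff W hn₂).2 hΨ₂')
  have ht₃' : 2 * y₃' + W.a₁ * x₃' + W.a₃ ≠ 0 :=
    t₂_ne_zero_of_three_zsmul W hn₃ ((three_zsmul_some_eq_zero_iff W hn₃).2 hΨ₃')
  -- the three transported harmonic polars: `ĥ(vᵢ) = αᵢ · gᵀ hᵢ`
  have hS₁ := split_smul W hl (rfl : grad W ![0, 1, 0] = grad W ![0, 1, 0]) (hess_split_zero W)
  obtain ⟨α₁, hα₁⟩ :=
    hhat_eq_smul_transpose_mulVec W h2 hg hE₁ hΨ₁ ht₁ hgv₁ one_ne_zero rfl hS₁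
  have hS₂ := split_smul W hz₂ (rfl : grad W ![x₂', y₂', 1] = grad W ![x₂', y₂', 1])
    (hess_split_affine W hE₂' hΨ₂')
  rw [← hw₂q] at hS₂
  obtain ⟨α₂, hα₂⟩ :=
    hhat_eq_smul_transpose_mulVec W h2 hg hE₂ hΨ₂ ht₂ hw₂.symm (pow_ne_zero 2 ht₂') rfl hS₂
  have hS₃ := split_smul W hz₃ (rfl : grad W ![x₃', y₃', 1] = grad W ![x₃', y₃', 1])
    (hess_split_affine W hE₃' hΨ₃')
  rw [← hw₃q] at hS₃
  obtain ⟨α₃, hα₃⟩ :=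
    hhat_eq_smul_transpose_mulVec W h2 hg hE₃ hΨ₃ ht₃ hw₃.symm (pow_ne_zero 2 ht₃') rfl hS₃
  -- `ĥ(Q₃) = Nᵀ ĥ(Q₂)`
  rw [hx', hy', hhat_negY] at hα₃
  rw [Matrix.mulVec_smul, smul_smul] at hα₁ hα₂ hα₃
  have hM : Matrix.of ![hhat W x₁ y₁, hhat W x₂ y₂, hhat W x₃ y₃] =
      Matrix.of ![(α₁ * l⁻¹) • (gᵀ *ᵥ ![W.a₁, 2, W.a₃]),
        (α₂ * (w₂ 2)⁻¹) • (gᵀ *ᵥ hhat W x₂' y₂'),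
        (α₃ * (w₃ 2)⁻¹) • (gᵀ *ᵥ ((Matrix.of ![![(1 : K), -W.a₁, 0], ![0, -1, 0], ![0, -W.a₃, 1]]) *ᵥ
          hhat W x₂' y₂'))] := by
    rw [← hα₁, ← hα₂, ← hα₃]
  rw [hM, det_rows_smul_transpose_mulVec, det_hhatO_u_negU, mul_zero]

end Main

end Literature.NumberTheory.EllipticCurves.FlexTransport
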